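import Summits.AtomisticToContinuum.FouriersLaw.Theorems.CageBudgetFeketeUnboundedHeatVariancePOfAbelEnergyPositivity
import Summits.AtomisticToContinuum.FouriersLaw.Theorems.HoelderEscapeProfileCornerNoDipProfileSupBound
import HarnessLib

/-!
# Stub `stub_relativeNegativeSpread_of_eventualAbelEnergyPositivity` of line `Sketch` — edge PE ⟹ P
(crux `CageBudgetFekete.UnboundedHeatVariance`, item stmt-AtomisticToContinuum-15771; `--supports` file)

WHAT. The registered edge stub of the skeleton `Cruxes/UnboundedHeatVariance/Lines/Sketch.lean` confining the
positivity requirement of edge E4 (`stub_relativeNegativeSpread_of_abelEnergyPositivity`) to the complement of a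
fixed core: in the crux's arena, if the Abel profile `S̄_ν(x) = Sb ν x = ν∫₀^∞ e^{-νt} S(x,t) dt` of the energy
kernel is nonnegative for all sites `|x| ≥ R₀` and all `0 < ν < ν₀` (negative values allowed in the core
`|x| < R₀`), then the relative negative spread P holds with `θ = 0 < 1`:
`Σ_x x²(S(x,0) − S̄_ν(x))⁺ ≤ θ·Σ_x x²(S̄_ν(x) − S(x,0))⁺ + K` for `0 < ν < ν₀`, with the `ν`-uniform constant
`K = Σ_x (1 + x²)|S(x,0)| + M·Σ_{|x| < R₀} x²`, `M` the kinematic sup bound of the Abel profile.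

HOW. Termwise: off the core `S̄_ν(x) ≥ 0` gives `x²(S(x,0) − S̄_ν(x))⁺ ≤ (1 + x²)|S(x,0)|` (landed
`Sketch.sq_mul_posPart_sub_le_weight_mul_abs`); in the core `(S(x,0) − S̄_ν(x))⁺ ≤ |S(x,0)| + |S̄_ν(x)| ≤
|S(x,0)| + M`, where `|S̄_ν(x)| ≤ M := Var_μ(h₀)` for ALL `ν > 0` and all `x` is the landed kinematic sup bound
`CornerNoDip.HeatProfile.stub_profileSupBound` (Cauchy–Schwarz/AM–GM along the measure-preserving flow and
`ν∫₀^∞ e^{-νt} dt = 1`). The weighted summabilities `Σ(1+x²)|S̄_ν| < ∞`, `Σ(1+x²)|S(·,0)| < ∞` are clauses (4), (5)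
of the fibre calculus `FibreCalculusSketch.fibreCalculus_proof`; the core majorant has finite support;
`Summable.tsum_le_tsum` compares the sums.

No definitions; one real-analysis helper lemma on weighted-summable sequences `ℤ → ℝ`, then the stub.
prover-line-stmt-AtomisticToContinuum-15771-c2-0, 2026-08-17.
-/

noncomputable section

namespace Summit.AtomisticToContinuum.FouriersLaw.Theorems.UnboundedHeatVariance.Sketch

open MeasureTheory Set Filter Topology
open Literature.MathematicalPhysics.KineticTheory.HeatConduction
open Summit.AtomisticToContinuum.FouriersLaw.Theses

/-! ### 1. The comparison of sums: positivity off a core, a sup bound in the core -/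

/-- **Negative spread under positivity off a core.** For weighted-summable `a, b : ℤ → ℝ` with `b x ≥ 0` for
`|x| ≥ R` and `|b x| ≤ M` everywhere, the negative second moment of the displacement `b − a` is capped
`ν`-uniformly: `Σ x²(a − b)⁺ ≤ Σ (1 + x²)|a| + Σ_{-R < x < R} x²·M`. [folklore] -/
theorem negSpread_le_weighted_add_core_of_nonneg_offCore {a b : ℤ → ℝ} {R : ℤ} {M : ℝ}
    (ha : Summable (fun x : ℤ => (1 + (x : ℝ) ^ 2) * |a x|))
    (hb : Summable (fun x : ℤ => (1 + (x : ℝ) ^ 2) * |b x|))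
    (hpos : ∀ x : ℤ, R ≤ |x| → 0 ≤ b x) (hM : ∀ x : ℤ, |b x| ≤ M) :
    ∑' x : ℤ, (x : ℝ) ^ 2 * max (a x - b x) 0 ≤
      (∑' x : ℤ, (1 + (x : ℝ) ^ 2) * |a x|) + ∑ x ∈ Finset.Ioo (-R) R, (x : ℝ) ^ 2 * M := by
  classical
  -- the finitely supported core majorant
  set core : ℤ → ℝ := fun x => if x ∈ Finset.Ioo (-R) R then (x : ℝ) ^ 2 * M else 0 with hcore
  have hM0 : 0 ≤ M := (abs_nonneg _).trans (hM 0)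
  have hcoreS : Summable core :=
    summable_of_ne_finset_zero (s := Finset.Ioo (-R) R) (fun x hx => if_neg hx)
  have hcoreT : ∑' x : ℤ, core x = ∑ x ∈ Finset.Ioo (-R) R, (x : ℝ) ^ 2 * M := by
    rw [tsum_eq_sum (s := Finset.Ioo (-R) R) (fun x hx => if_neg hx)]
    exact Finset.sum_congr rfl (fun x hx => if_pos hx)
  -- the termwise bound
  have hpt : ∀ x : ℤ, (x : ℝ) ^ 2 * max (a x - b x) 0 ≤ (1 + (x : ℝ) ^ 2) * |a x| + core x := by
    intro x
    by_cases hx : x ∈ Finset.Ioo (-R) R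
    · have h1 : max (a x - b x) 0 ≤ |a x| + M :=
        max_le (by linarith [le_abs_self (a x), neg_abs_le (b x), hM x]) (by positivity)
      have h2 : 0 ≤ max (a x - b x) 0 := le_max_right _ _
      have hc : core x = (x : ℝ) ^ 2 * M := if_pos hx
      rw [hc]
      nlinarith [sq_nonneg (x : ℝ), abs_nonneg (a x)]
    · have hRx : R ≤ |x| := by
        rw [Finset.mem_Ioo, ← abs_lt] at hx
        exact not_lt.1 hx
      have hc : core x = 0 := if_neg hx
      rw [hc, add_zero]
      exact sq_mul_posPart_sub_le_weight_mul_abs (hpos x hRx) x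
  calc ∑' x : ℤ, (x : ℝ) ^ 2 * max (a x - b x) 0
      ≤ ∑' x : ℤ, ((1 + (x : ℝ) ^ 2) * |a x| + core x) :=
        Summable.tsum_le_tsum hpt (summable_sq_mul_posPart_of_weighted (weighted_summable_sub ha hb))
          (ha.add hcoreS)
    _ = (∑' x : ℤ, (1 + (x : ℝ) ^ 2) * |a x|) + ∑' x : ℤ, core x := ha.tsum_add hcoreS
    _ = (∑' x : ℤ, (1 + (x : ℝ) ^ 2) * |a x|) + ∑ x ∈ Finset.Ioo (-R) R, (x : ℝ) ^ 2 * M := by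
        rw [hcoreT]

/-! ### 2. The stub -/

/-- **PE — `stub_relativeNegativeSpread_of_eventualAbelEnergyPositivity` (registered signature, verbatim): Abel
energy positivity OUTSIDE a fixed core implies the relative negative spread P.** In the arena of
`CageBudgetFekete.UnboundedHeatVariance`, if `S̄_ν(x) ≥ 0` for all `|x| ≥ R₀` and all `0 < ν < ν₀`, then with
`θ = 0`, `K = Σ_x (1 + x²)|S(x,0)| + M·Σ_{|x| < R₀} x²` (`M` the kinematic sup bound `|S̄_ν(x)| ≤ M` of
`CornerNoDip.HeatProfile.stub_profileSupBound`) and the same `ν₀`: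
`Σ_x x²(S(x,0) − S̄_ν(x))⁺ ≤ θ·Σ_x x²(S̄_ν(x) − S(x,0))⁺ + K` for `0 < ν < ν₀`
(fibre calculus `FibreCalculusSketch.fibreCalculus_proof`, clauses 4–5, and
`negSpread_le_weighted_add_core_of_nonneg_offCore`). [folklore] -/
theorem stub_relativeNegativeSpread_of_eventualAbelEnergyPositivity :
    ∀ ω₂ lam β γ : ℝ, 0 < ω₂ → 0 < lam → 0 < β → ∀ T : ℝ, 0 < T → ∀ μ : MeasureTheory.Measure Literature.MathematicalPhysics.KineticTheory.HeatConduction.ChainConfig, (Literature.MathematicalPhysics.KineticTheory.HeatConduction.pinnedChain ω₂ lam β γ).IsChainGibbsMeasure T μ → Literature.MathematicalPhysics.KineticTheory.HeatConduction.IsShiftInvariant μ → μ.map (fun σ : Literature.MathematicalPhysics.KineticTheory.HeatConduction.ChainConfig => fun x : ℤ => ((σ x).1, -(σ x).2)) = μ → ∀ D : Literature.MathematicalPhysics.KineticTheory.HeatConduction.InfiniteChainDynamics (Literature.MathematicalPhysics.KineticTheory.HeatConduction.pinnedChain ω₂ lam β γ), D.PreservesMeasure μ → (∀ t : ℝ,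 ∀ᵐ σ ∂μ, D.flow t (Literature.MathematicalPhysics.KineticTheory.HeatConduction.shift σ) = Literature.MathematicalPhysics.KineticTheory.HeatConduction.shift (D.flow t σ)) → (∀ t : ℝ, D.HasAbsConvergentCorrelation μ t) → Continuous (fun t : ℝ => D.currentCorrelation μ t) → ∀ h : Literature.MathematicalPhysics.KineticTheory.HeatConduction.ChainConfig → ℤ → ℝ, h = (fun (σ : Literature.MathematicalPhysics.KineticTheory.HeatConduction.ChainConfig) (x : ℤ) => (σ x).2 ^ 2 / 2 + (Literature.MathematicalPhysics.KineticTheory.HeatConduction.pinnedChain ω₂ lam β γ).U (σ x).1 + ((Literature.MathematicalPhysics.KineticTheory.HeatConduction.pinnedChain ω₂ lam β γ).V ((σ (x + 1)).1 - (σ x).1) + (Literature.MathematicalPhysics.KineticTheory.HeatConduction.pinnedChain ω₂ lam β γ).V ((σ x).1 - (σ (x - 1)).1)) / 2) → ∀ S : ℤ → ℝ → ℝ, S = (fun (x : ℤ) (t : ℝ) => ∫ σ, (h σ 0 - ∫ σ', h σ' 0 ∂μ) * (h (D.flow t σ) x - ∫ σ', h σ' 0 ∂μ) ∂μ) → ∀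 Sb : ℝ → ℤ → ℝ, Sb = (fun (ν : ℝ) (x : ℤ) => ν * ∫ t in Set.Ioi (0:ℝ), Real.exp (-(ν * t)) * S x t) → (∃ R₀ : ℕ, ∃ ν₀ : ℝ, 0 < ν₀ ∧ ∀ ν : ℝ, 0 < ν → ν < ν₀ → ∀ x : ℤ, (R₀ : ℤ) ≤ |x| → 0 ≤ Sb ν x) → ∃ θ K ν₀ : ℝ, θ < 1 ∧ 0 < ν₀ ∧ ∀ ν : ℝ, 0 < ν → ν < ν₀ → ∑' x : ℤ, (x : ℝ) ^ 2 * max (S x 0 - Sb ν x) 0 ≤ θ * (∑' x : ℤ, (x : ℝ) ^ 2 * max (Sb ν x - S x 0) 0) + K := by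
  intro ω₂ lam β γ hω hl hβ T hT μ hG hSI hRefl D hP hShift _ _ h hh S hS Sb hSb hPE
  obtain ⟨R₀, ν₀, hν₀, hpos⟩ := hPE
  obtain ⟨-, -, -, h4, h5, -, -, -, -, -, -, -⟩ :=
    Summit.AtomisticToContinuum.FouriersLaw.Theorems.FibreCalculusSketch.fibreCalculus_proof ω₂ lam β γ hω hl hβ T
      hT μ hG hSI hRefl D hP hShift h hh S hS Sb hSb _ rfl _ rfl _ rfl _ rfl
  obtain ⟨M, hM⟩ :=
    Summit.AtomisticToContinuum.FouriersLaw.Theorems.CornerNoDip.HeatProfile.stub_profileSupBound ω₂ lam β γ hω hl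
      hβ T hT μ hG hSI hRefl D hP hShift h hh S hS Sb hSb
  refine ⟨0, (∑' x : ℤ, (1 + (x : ℝ) ^ 2) * |S x 0|) + ∑ x ∈ Finset.Ioo (-(R₀ : ℤ)) R₀, (x : ℝ) ^ 2 * M, ν₀,
    zero_lt_one, hν₀, fun ν hν hνν₀ => ?_⟩
  rw [zero_mul, zero_add]
  exact negSpread_le_weighted_add_core_of_nonneg_offCore h5 (h4 ν hν) (fun x hx => hpos ν hν hνν₀ x hx)
    (fun x => hM ν hν x)

end Summit.AtomisticToContinuum.FouriersLaw.Theorems.UnboundedHeatVariance.Sketch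

end
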